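import Summits.QuantumFields.BalabanUV.Beta.GAN24.SymRMChargeFreeFace
import Summits.QuantumFields.BalabanUV.Beta.GAN24.WardResidualRotatedVertexTransported

/-!
# `BalabanUV.Beta.GAN24.SymRMTransportedFace` — binder row G-an2-4 ∕ (CONV-C), CT-W route «WC-TL» ∕ (Q-R) «QR-LL», the (S) row of RULING R-gan24p1-g27-1, piece (S-β),
# PART 4: **THE TRANSPORTED (β)-LETTER VANISHES — THE COARSE MULTIPLIER–MULTIPLIER KERNEL `(G_{j′} ∘ (β)(ν,y′) ∘ G_{j′})(Lc•x′, Lc•z′)` IS ZERO AT EVERY SLOT**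
# (centred root, `Lc` odd, every `cΛ`, every level; the literal E15∕E18 quantity of the OWNER gan24-p1's engine, `s_β = −(cE·wE)•mmRead(G (β) G)`, up to the scalar): p2 g35's
# sandwich read-out `SandwichReadoutSiteDep.hasSum_sandwich_readout_coDressKBmAt` at `V := (β)(ν,y′) = vertexOfM G Lc (symRMAn1 Lc cΛ j y) ν y′` composed with PART 3b's
# exit-face charge-freeness (G-an2-4 formalisation swarm → CRUX TEAM (2), seat `b2b-balaban-gan24-formalise-leaf-02`, gen 55)

NOT IN PRINT; OUR BOOKKEEPING ([folklore] composition BY NAME, following p2 g38's `WardResidualRotatedVertexTransported.hasSum_prod_transported_rotatedVertex_comb` token for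
token with (α) ↦ (β): p2 g35's read-out, leaf-06's Kronecker charges `StepResolventLegCharges.hasSum_KInvStep_inr_inl ∕ _inl_inr` + `MultiplierZeroMass.hasSum_KInvStep_mm_left ∕
_right`, this seat's `CubicPushFaceCharge.sum_sum_face_kron`, an2's `SecondOrderResponse.vertexFamily_vertexOfM`, an1's `vertexFamily_symRMAn1`, PART 3b
`SymRMChargeFreeFace.hasSum_face_vertexOfM_symRMAn1_comb`; 0 `def`, 0 cited fact, 0 `def … : Prop`, 0 sorry).  HONEST FRAMING (cell contract, verbatim): «discharging
`BetaPertH` makes Bałaban's UV stability UNCONDITIONAL — a real constructive-QFT result; it is NOT the continuum limit and NOT the Clay problem.»  HONEST DEPENDENCY (verbatim):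
«continuum YM on T⁴ ⇐ BetaPertH ∧ nine spine estimates (0/9 proved); BetaPertH ⇐ (D1) ∧ (D4) ∧ CAP+tail; G-an2-4 gates asym, D1 and NE2/3/4.»

* §1 `biLoc_vertexOfM_symRMAn1_comb` — the (β)-piece is bi-localised at its slot (an2 + an1 BY NAME).
* §2 **`hasSum_transported_vertexOfM_symRMAn1_comb`**: `HasSum ((x′,z′) ↦ (G_{j′} ∘ (β)(ν,y′) ∘ G_{j′})(Lc•x′, Lc•z′)_{(inr α, inr β)}) 0`, `G_{j′} = coDressKBmAt ρ_c Lc (KInvStep Lc j′)`,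
  EVERY `j′ j y ν y′ α β cΛ` — so the (β)-part of the σ-letter of the S-step tower (`WardResidualSRecursion.divW_WrecAt_succ_vertexForm`'s `Σ_v mmRead Lc (G_j ∘ Ψ ∘ G_j)` with
  `Ψ ∋ vertexOfM G_{j} … (symRMAn1 Lc cΛ j ·)`) is IDENTICALLY ZERO as a coarse kernel: its plain AND transported charge profiles vanish at every slot, so it carries no
  (M0)∕(Π)∕(INV) obligation in either currency of the (S) row.
HONEST: (S-β) in both currencies; NOTHING of (S) for α+γ ∕ (S-τ) ∕ (Q-R) ∕ (LT) ∕ (Q-L) ∕ (C) ∕ «T2Shape» ∕ (hW, hWall); NEVER «G-an2-4 closed» as (CONV-C); NOT D1, NOT `BetaPertH`,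
NOT continuum, NOT Clay.  2026-08-22; no existing file touched.
-/

noncomputable section

open Finset
open scoped BigOperators
open Literature.MathematicalPhysics.QuantumFieldTheory
open Literature.MathematicalPhysics.QuantumFieldTheory.Balaban1983to89
open Literature.MathematicalPhysics.QuantumFieldTheory.Balaban1983to89.Beta
open B12Sec2to5 (l1)
open ExpKernelCalculus (Site MKer BiLoc Decays VertexFamily comp Zl)
open AffineAveraging (box toSite)
open AveragingContoursRooted (ctr ctrOff ctrOff_mem_box)
open OneStepResolventKernel (Fib)
open OneStepKernelFamily (KInvStep decays_KInvStep)
open SecondOrderResponse (colM vertexOfM vertexFamily_vertexOfM)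
open StepJetData (biLoc_weaken)
open Summit.QuantumFields.BalabanUV.Beta.AxialDressingRooted (one_le_of_neZero coDressKBmAt decays_coDressKBmAt_KInvStep)
open Summit.QuantumFields.BalabanUV.Beta.SymWardLettersAn1 (symRMAn1 vertexFamily_symRMAn1)
open Summit.QuantumFields.BalabanUV.Beta.GAN24.SandwichReadoutSiteDep (hasSum_sandwich_readout_coDressKBmAt)
open Summit.QuantumFields.BalabanUV.Beta.GAN24.StepResolventLegCharges (hasSum_KInvStep_inr_inl hasSum_KInvStep_inl_inr)
open Summit.QuantumFields.BalabanUV.Beta.GAN24.MultiplierZeroMass (hasSum_KInvStep_mm_left hasSum_KInvStep_mm_right)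
open Summit.QuantumFields.BalabanUV.Beta.GAN24.CubicPushFaceCharge (sum_sum_face_kron)
open Summit.QuantumFields.BalabanUV.Beta.GAN24.SymRMChargeFreeFace (hasSum_face_vertexOfM_symRMAn1_comb)

namespace Summit.QuantumFields.BalabanUV.Beta.GAN24.SymRMTransportedFace

variable {Lc : ℕ} [NeZero Lc]

/-! ## §1 The (β)-piece is bi-localised at its slot -/

/-- [folklore] **THE (β)-PIECE IS BI-LOCALISED AT ITS SLOT**: for `G = coDressKBmAt ρ_c Lc (KInvStep Lc j′)` and every `cΛ j y ν y′` there are `C, m > 0` with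
`BiLoc (vertexOfM G Lc (symRMAn1 Lc cΛ j y) ν y′) (Lc•y′) (Lc•y′) C m` (an2's `vertexFamily_vertexOfM` on an1's `vertexFamily_symRMAn1`, rates matched by `biLoc_weaken`). -/
theorem biLoc_vertexOfM_symRMAn1_comb (cΛ : ℝ) (j' j : ℕ) (y : Fin (3 + 1) → ℤ) (ν : Fin (3 + 1)) (y' : Site (3 + 1)) :
    ∃ C m : ℝ, 0 < m ∧ BiLoc (vertexOfM (coDressKBmAt (ctr 4 Lc) Lc (KInvStep (d := 3) Lc j')) Lc (symRMAn1 Lc cΛ j y) ν y')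
      ((Lc : ℤ) • y') ((Lc : ℤ) • y') C m := by
  obtain ⟨δG, CG, hδG, hCG, hG⟩ := decays_coDressKBmAt_KInvStep (d := 3) (ctrOff_mem_box (one_le_of_neZero Lc)) j'
  obtain ⟨C, δ, hδ, hV⟩ := vertexFamily_symRMAn1 (Lc := Lc) (one_le_of_neZero Lc) cΛ j
  -- match the rates: the table at `min δ δG ≤ δG`
  have hC0 : 0 ≤ C := ((hV y) 0 0).nonneg (Sum.inl 0)
  have hV' : VertexFamily (symRMAn1 Lc cΛ j y) Lc C (min δ δG) := fun μ w => biLoc_weaken (hV y μ w) le_rfl (min_le_left _ _)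
  have h := vertexFamily_vertexOfM (N := Lc) hG hCG hV' (lt_min hδ hδG) (min_le_right _ _) ν y'
  exact ⟨_, _, half_pos (lt_min hδ hδG), h⟩

/-! ## §2 The transported (β)-letter vanishes -/

/-- NOT IN PRINT; OUR BOOKKEEPING.  **THE TRANSPORTED (β)-LETTER IS ZERO** (centred root, `Lc` odd; every `cΛ j′ j y ν y′ α β`):
`HasSum ((x′,z′) ↦ (G_{j′} ∘ vertexOfM G_{j′} Lc (symRMAn1 Lc cΛ j y) ν y′ ∘ G_{j′})(Lc•x′, Lc•z′) (inr α) (inr β)) 0`, `G_{j′} = coDressKBmAt ρ_c Lc (KInvStep Lc j′)` —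
p2 g35's sandwich read-out leaves ONLY the exit-face two-leg charges of the letter, and those vanish (PART 3b). -/
theorem hasSum_transported_vertexOfM_symRMAn1_comb (hodd : Odd Lc) (cΛ : ℝ) (j' j : ℕ) (y : Fin (3 + 1) → ℤ) (ν : Fin (3 + 1))
    (y' : Fin (3 + 1) → ℤ) (α β : Fin (3 + 1)) :
    HasSum (fun xz : Site (3 + 1) × Site (3 + 1) =>
        comp (comp (coDressKBmAt (ctr 4 Lc) Lc (KInvStep (d := 3) Lc j'))
          (vertexOfM (coDressKBmAt (ctr 4 Lc) Lc (KInvStep (d := 3) Lc j')) Lc (symRMAn1 Lc cΛ j y) ν y'))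
          (coDressKBmAt (ctr 4 Lc) Lc (KInvStep (d := 3) Lc j')) ((Lc : ℤ) • xz.1) ((Lc : ℤ) • xz.2) (Sum.inr α) (Sum.inr β)) 0 := by
  classical
  have hLc : 1 ≤ Lc := one_le_of_neZero Lc
  have hr := ctrOff_mem_box (d := 3 + 1) hLc
  obtain ⟨δ, C, hδ, -, hK⟩ := decays_KInvStep (d := 3) (Lc := Lc) j'
  obtain ⟨CV, m, hm, hV⟩ := biLoc_vertexOfM_symRMAn1_comb (Lc := Lc) cΛ j' j y ν y'
  -- the sandwich read-out at V := (β)(ν,y′) with the Kronecker charges of `KInvStep Lc j′`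
  have h := hasSum_sandwich_readout_coDressKBmAt hLc hr hK hδ hV hm α β
    (cL := fun α κ => -(if κ = α then ((((Lc ^ (j' + 1) : ℕ) : ℝ)) ^ (3 + 1 + 1))⁻¹ else 0))
    (cR := fun κ' μ => if κ' = μ then ((((Lc ^ (j' + 1) : ℕ) : ℝ)) ^ (3 + 1 + 1))⁻¹ else 0)
    (fun t α κ => hasSum_KInvStep_inr_inl j' α κ t) (fun t α m => hasSum_KInvStep_mm_left j' α m t)
    (fun u κ' μ => hasSum_KInvStep_inl_inr j' κ' μ u) (fun u m μ => hasSum_KInvStep_mm_right j' m μ u)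
  simp only [sum_sum_face_kron] at h
  rw [tsum_neg, tsum_mul_left] at h
  -- the face-restricted pair sum of (β) is ZERO (PART 3b)
  have hw := hasSum_face_vertexOfM_symRMAn1_comb (Lc := Lc) hodd cΛ j' j y ν y' α β
  have e : (∑' yw : Site (3 + 1) × Site (3 + 1),
      (if yw.1 α % (Lc : ℤ) = (Lc : ℤ) - 1 ∧ yw.2 β % (Lc : ℤ) = (Lc : ℤ) - 1 then
        vertexOfM (coDressKBmAt (ctr 4 Lc) Lc (KInvStep (d := 3) Lc j')) Lc (symRMAn1 Lc cΛ j y) ν y' yw.1 yw.2 (Sum.inl α) (Sum.inl β) else 0))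
      = 0 := (hw.congr_fun fun yw => by rw [boole_mul]).tsum_eq
  rw [e, mul_zero, neg_zero] at h
  exact h

end Summit.QuantumFields.BalabanUV.Beta.GAN24.SymRMTransportedFace

end
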